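import Mathlib
import HarnessLib
import Literature.Probability.Distributions.DistributionalTransform

/-!
# The Glivenko–Cantelli sandwich (deterministic part): monotone `[0,1]`-valued functions that
# converge to a distribution function at the points of its quantile grid — together with their
# strict-inequality companions at the left limits — converge UNIFORMLY on `ℝ`

HONEST FRAMING: exact (Metropolis-corrected) sampling algorithms for lattice gauge theory;
figures of merit are autocorrelation/cost numbers at stated couplings and volumes; no
continuum-physics claim.

Venture `LatticeQCDFlow` (cell pub-lqcd), topic `Scoring`; FANOUT row 4 (`s0-u1-b`, rung S0-B:
two independent codes compared column by column).  Row 4's `ε = 0` rung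
(`Scoring/SelfNormalisedReweightingConsistency`, `…/ReweightedHistogramConsistency`) proves that
every printed column of a flow card is strongly consistent and that the reweighted histogram of a
DISCRETE statistic (the topological charge) converges in total variation; for a CONTINUOUS
statistic (plaquette, action density, a Wilson loop) the printed object is the reweighted
EMPIRICAL DISTRIBUTION FUNCTION `t ↦ Σ w̃ᵢ·1{Oᵢ ≤ t} / Σ w̃ᵢ`, and the matching statement —
uniform convergence on `ℝ`, the Glivenko–Cantelli theorem — was left NOT CLAIMED.  Mathlib has no
Glivenko–Cantelli theorem.  This file is its DETERMINISTIC half, stated once for any sequence of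
functions so that the classical (equal weights) and the self-normalised reweighted versions
(`Scoring/GlivenkoCantelli`) are both one strong-law application away:

let `F = cdf ρ` be the distribution function of a measure `ρ` on `ℝ` (Mathlib's
`ProbabilityTheory.cdf`, a Stieltjes function: monotone, right-continuous, limits `0`/`1`) and
`F(t−) = leftLim F t`; let `Fₙ : ℝ → ℝ` be monotone with `0 ≤ Fₙ ≤ 1`, and `Gₙ` any functions with
`Fₙ(s) ≤ Gₙ(t)` for `s < t` (for an empirical distribution function, `Gₙ(t)` = the mass of
`(−∞, t)`).  If `Fₙ(q) → F(q)` and `Gₙ(q) → F(q−)` at every point `q = q(j/k) = inf {x : j/k ≤ F x}`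
of the QUANTILE GRID (`k, j ∈ ℕ`), then `sup_t |Fₙ(t) − F(t)| → 0`
(**`tendstoUniformly_cdf_of_tendsto_grid`**; the everywhere-convergence form
**`tendstoUniformly_cdf_of_tendsto`**).  The proof is the textbook sandwich: with `j = ⌊k·F(t)⌋`,
`q(j/k) ≤ t < q((j+1)/k)` by the Galois property of the quantile
(`Literature.Probability.Distributions.sInf_setOf_le_cdf_le_iff`), `F(q(u)) ≥ u ≥ F(q(u)−)`
(`le_cdf_sInf`, `leftLim_cdf_sInf_le`, ibid.), so
`Fₙ(q(j/k)) − j/k − 1/k ≤ Fₙ(t) − F(t) ≤ Gₙ(q((j+1)/k)) − (j+1)/k + 1/k`, the two tails being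
handled by `0 ≤ Fₙ ≤ 1`.  A countable-reduction lemma (**`tendsto_cdf_of_dense`**: convergence on a
dense set plus at the jumps of `F` gives convergence of `Fₙ(t)`, `Gₙ(t)` at every `t`) and the
dictionary `leftLim (cdf ρ) t = ρ.real (Iio t)` (**`leftLim_cdf_eq_real`**) complete the kit.
Printed counterparts NAMED ONLY (nothing cited as a fact): Glivenko (1933), Cantelli (1933);
van der Vaart, *Asymptotic Statistics* (1998) Thm 19.1; Durrett, *Probability: theory and
examples* (2019) Thm 2.4.9.  NEW WORK of the cell (our formalisation of a classical proof); no
definition is introduced.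

## Content (`F = cdf ρ`, `q(u) = sInf {x | u ≤ F x}`)

* `cdf_quantile_spec` — for `u ∈ (0,1)`: `u ≤ F(q u)`, `F(q(u)−) ≤ u`, `q u ≤ b ↔ u ≤ F b`;
* **`tendstoUniformly_cdf_of_tendsto_grid`**, **`tendstoUniformly_cdf_of_tendsto`** — the sandwich;
* **`tendsto_cdf_of_dense`** — countable reduction (dense set + jump points ⇒ everywhere);
* `leftLim_cdf_eq_real` — `F(t−) = ρ.real (Iio t)` for a probability measure.

NOT CLAIMED: uniform convergence of the left limits `Gₙ`; rates (Dvoretzky–Kiefer–Wolfowitz);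
higher dimensions / VC classes; any number of ours re-scored.
-/

noncomputable section

namespace Summit.Ventures.LatticeQCDFlow.Scoring.GlivenkoCantelli

open MeasureTheory ProbabilityTheory Filter Set Function
open scoped Topology

/-! ## §1 The quantile grid of a distribution function -/

section Quantile

variable (ρ : Measure ℝ)

/-- The lower quantile `q(u) = inf {x : u ≤ F(x)}` of `F = cdf ρ` at a level `u ∈ (0,1)`:
`u ≤ F(q(u))` (right-continuity), `F(q(u)−) ≤ u`, and the Galois property `q(u) ≤ b ↔ u ≤ F(b)`.
[folklore] (the three Literature lemmas `le_cdf_sInf`, `leftLim_cdf_sInf_le`,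
`sInf_setOf_le_cdf_le_iff` bundled) -/
theorem cdf_quantile_spec {u : ℝ} (hu0 : 0 < u) (hu1 : u < 1) :
    u ≤ cdf ρ (sInf {x | u ≤ cdf ρ x})
      ∧ leftLim (cdf ρ) (sInf {x | u ≤ cdf ρ x}) ≤ u
      ∧ ∀ b : ℝ, sInf {x | u ≤ cdf ρ x} ≤ b ↔ u ≤ cdf ρ b :=
  ⟨Literature.Probability.Distributions.le_cdf_sInf ρ ⟨hu0, hu1⟩,
    Literature.Probability.Distributions.leftLim_cdf_sInf_le ρ ⟨hu0, hu1⟩,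
    fun b => Literature.Probability.Distributions.sInf_setOf_le_cdf_le_iff ρ hu0 hu1 b⟩

/-- `F(t−) ≤ F(t)`. [folklore] -/
theorem leftLim_cdf_le (t : ℝ) : leftLim (cdf ρ) t ≤ cdf ρ t :=
  (monotone_cdf ρ).leftLim_le le_rfl

/-- `F(s) ≤ F(t−)` for `s < t`. [folklore] -/
theorem cdf_le_leftLim {s t : ℝ} (h : s < t) : cdf ρ s ≤ leftLim (cdf ρ) t :=
  (monotone_cdf ρ).le_leftLim h

/-- **`F(t−) = ρ(−∞, t)`** for a probability measure `ρ` on `ℝ`. [folklore] -/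
theorem leftLim_cdf_eq_real [IsProbabilityMeasure ρ] (t : ℝ) :
    leftLim (cdf ρ) t = ρ.real (Iio t) := by
  rw [measureReal_def, Literature.Probability.Distributions.measure_Iio_eq_ofReal_leftLim ρ t,
    ENNReal.toReal_ofReal]
  exact le_trans (cdf_nonneg ρ (t - 1)) (cdf_le_leftLim ρ (by linarith))

/-- A jump-free point of `F` carries no atom: `F(t−) = F(t) ↔ ρ {t} = 0` (probability measure).
[folklore] -/
theorem leftLim_cdf_eq_iff [IsProbabilityMeasure ρ] (t : ℝ) :
    leftLim (cdf ρ) t = cdf ρ t ↔ ρ {t} = 0 := by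
  rw [Literature.Probability.Distributions.measure_singleton_eq_ofReal ρ t, ENNReal.ofReal_eq_zero,
    sub_nonpos]
  exact ⟨fun h => h.ge, fun h => le_antisymm (leftLim_cdf_le ρ t) h⟩

end Quantile

/-! ## §2 The sandwich: grid convergence ⇒ uniform convergence -/

section Sandwich

variable (ρ : Measure ℝ) {F G : ℕ → ℝ → ℝ}

/-- **THE GLIVENKO–CANTELLI SANDWICH.**  `F = cdf ρ`; `Fₙ` monotone with `0 ≤ Fₙ ≤ 1`; `Gₙ` with
`Fₙ(s) ≤ Gₙ(t)` whenever `s < t`.  If at every point `q = inf {x : j/k ≤ F(x)}` of the quantile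
grid (`k, j ∈ ℕ`; for `j/k ∉ (0,1)` the point is a harmless junk real) `Fₙ(q) → F(q)` and
`Gₙ(q) → F(q−)`, then `Fₙ → F` UNIFORMLY on `ℝ`. [ours] (our formalisation of the classical proof:
`j = ⌊k F(t)⌋`, `q(j/k) ≤ t < q((j+1)/k)`, monotone sandwich, mesh `1/k`) -/
theorem tendstoUniformly_cdf_of_tendsto_grid (hmono : ∀ n, Monotone (F n))
    (h0 : ∀ n t, 0 ≤ F n t) (h1 : ∀ n t, F n t ≤ 1) (hFG : ∀ n s t, s < t → F n s ≤ G n t)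
    (hF : ∀ k j : ℕ, Tendsto (fun n => F n (sInf {x | (j : ℝ) / k ≤ cdf ρ x})) atTop
      (𝓝 (cdf ρ (sInf {x | (j : ℝ) / k ≤ cdf ρ x}))))
    (hG : ∀ k j : ℕ, Tendsto (fun n => G n (sInf {x | (j : ℝ) / k ≤ cdf ρ x})) atTop
      (𝓝 (leftLim (cdf ρ) (sInf {x | (j : ℝ) / k ≤ cdf ρ x})))) :
    TendstoUniformly F (cdf ρ) atTop := by
  rw [Metric.tendstoUniformly_iff]
  intro ε hε
  have hε2 : 0 < ε / 2 := half_pos hε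
  -- mesh `1/K < ε/2`
  obtain ⟨k, hk⟩ := exists_nat_one_div_lt hε2
  set K : ℕ := k + 1 with hK
  have hKc : (K : ℝ) = k + 1 := by simp [hK]
  have hK0 : (0 : ℝ) < K := by positivity
  have hmesh : 1 / (K : ℝ) < ε / 2 := by rwa [hKc]
  -- the grid point of level `j/K`
  set q : ℕ → ℝ := fun j => sInf {x | (j : ℝ) / K ≤ cdf ρ x} with hq
  -- eventually every grid deviation at mesh `K` is `< ε/2`
  have hev : ∀ᶠ n in atTop, ∀ j ∈ Finset.range (K + 1),
      dist (F n (q j)) (cdf ρ (q j)) < ε / 2 ∧ dist (G n (q j)) (leftLim (cdf ρ) (q j)) < ε / 2 :=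
    (Finset.eventually_all _).2 fun j _ =>
      ((Metric.tendsto_nhds.1 (hF K j)) _ hε2).and ((Metric.tendsto_nhds.1 (hG K j)) _ hε2)
  filter_upwards [hev] with n hn t
  -- quantile facts at an interior level `j/K`, `1 ≤ j ≤ K - 1`
  have hspec : ∀ j : ℕ, 1 ≤ j → j + 1 ≤ K →
      (j : ℝ) / K ≤ cdf ρ (q j) ∧ leftLim (cdf ρ) (q j) ≤ (j : ℝ) / K
        ∧ ∀ b : ℝ, q j ≤ b ↔ (j : ℝ) / K ≤ cdf ρ b := by
    intro j hj1 hjK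
    have hu0 : (0 : ℝ) < (j : ℝ) / K := by
      have : (1 : ℝ) ≤ j := by exact_mod_cast hj1
      positivity
    have hu1 : (j : ℝ) / K < 1 := by
      rw [div_lt_one hK0]
      exact_mod_cast hjK
    exact cdf_quantile_spec ρ hu0 hu1
  -- deviations at the grid, unpacked
  have hdevF : ∀ j : ℕ, j + 1 ≤ K + 1 → cdf ρ (q j) - ε / 2 < F n (q j) := by
    intro j hj
    have h := (hn j (Finset.mem_range.2 (by omega))).1
    rw [Real.dist_eq] at h
    linarith [(abs_sub_lt_iff.1 h).2]
  have hdevG : ∀ j : ℕ, j + 1 ≤ K + 1 → G n (q j) < leftLim (cdf ρ) (q j) + ε / 2 := by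
    intro j hj
    have h := (hn j (Finset.mem_range.2 (by omega))).2
    rw [Real.dist_eq] at h
    linarith [(abs_sub_lt_iff.1 h).1]
  -- the level of `t`: `j/K ≤ F(t) < (j+1)/K`
  have hFt0 : 0 ≤ cdf ρ t := cdf_nonneg ρ t
  have hFt1 : cdf ρ t ≤ 1 := cdf_le_one ρ t
  set j : ℕ := ⌊(K : ℝ) * cdf ρ t⌋₊ with hj
  have hjle : (j : ℝ) ≤ K * cdf ρ t := Nat.floor_le (by positivity)
  have hjlt : (K : ℝ) * cdf ρ t < j + 1 := Nat.lt_floor_add_one _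
  have hjK : j ≤ K := by
    have h : (j : ℝ) ≤ K := hjle.trans (by nlinarith)
    exact_mod_cast h
  rw [Real.dist_eq, abs_sub_lt_iff]
  constructor
  · -- `F(t) - Fₙ(t) < ε`: lower sandwich through the grid point `q(j')`, `j' = min j (K - 1)`
    set j' : ℕ := min j (K - 1) with hj'
    by_cases hj'0 : j' = 0
    · -- then `F(t) ≤ 1/K`
      have hsmall : cdf ρ t ≤ 1 / K := by
        rw [hj'] at hj'0
        rcases Nat.min_eq_zero_iff.1 hj'0 with h | h
        · -- `j = 0`: `K F(t) < 1`
          rw [le_div_iff₀ hK0]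
          have e : (j : ℝ) = 0 := by exact_mod_cast h
          linarith [mul_comm (K : ℝ) (cdf ρ t)]
        · -- `K = 1`
          have e : (K : ℝ) = 1 := by
            have : K = 1 := by omega
            exact_mod_cast this
          rw [e, div_one]
          exact hFt1
      linarith [h0 n t]
    · have hj'1 : 1 ≤ j' := Nat.one_le_iff_ne_zero.2 hj'0
      have hj'K : j' + 1 ≤ K := by omega
      obtain ⟨hFq, -, hgal⟩ := hspec j' hj'1 hj'K
      -- `q(j') ≤ t` since `j'/K ≤ j/K ≤ F(t)`
      have hle : (j' : ℝ) / K ≤ cdf ρ t := by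
        have h1' : (j' : ℝ) ≤ j := by exact_mod_cast Nat.min_le_left j (K - 1)
        rw [div_le_iff₀ hK0]
        linarith [mul_comm (K : ℝ) (cdf ρ t)]
      have hqt : q j' ≤ t := (hgal t).2 hle
      -- `F(t) ≤ j'/K + 1/K`
      have hup : cdf ρ t ≤ (j' : ℝ) / K + 1 / K := by
        rcases le_or_gt j (K - 1) with h | h
        · have e : j' = j := Nat.min_eq_left h
          rw [e, ← add_div, le_div_iff₀ hK0]
          linarith [mul_comm (K : ℝ) (cdf ρ t)]
        · have e : j' = K - 1 := Nat.min_eq_right h.le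
          have e' : (j' : ℝ) = K - 1 := by
            rw [e, Nat.cast_sub (by omega), Nat.cast_one]
          rw [e', ← add_div, sub_add_cancel, div_self hK0.ne']
          exact hFt1
      have hmn : F n (q j') ≤ F n t := hmono n hqt
      linarith [hdevF j' (by omega)]
  · -- `Fₙ(t) - F(t) < ε`: upper sandwich through the grid point `q(j+1)`
    rcases le_or_gt (j + 2) K with h | h
    · obtain ⟨-, hLq, hgal⟩ := hspec (j + 1) (by omega) (by omega)
      -- `t < q(j+1)` since `F(t) < (j+1)/K`
      have hlt : ¬ ((j + 1 : ℕ) : ℝ) / K ≤ cdf ρ t := by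
        intro hle
        rw [div_le_iff₀ hK0] at hle
        push_cast at hle
        linarith [mul_comm (K : ℝ) (cdf ρ t)]
      have htq : t < q (j + 1) := lt_of_not_ge fun hge => hlt ((hgal t).1 hge)
      have hmn : F n t ≤ G n (q (j + 1)) := hFG n t _ htq
      have hlev : ((j + 1 : ℕ) : ℝ) / K ≤ cdf ρ t + 1 / K := by
        rw [div_le_iff₀ hK0, add_mul, div_mul_cancel₀ _ hK0.ne']
        push_cast
        linarith [mul_comm (K : ℝ) (cdf ρ t)]
      linarith [hdevG (j + 1) (by omega)]
    · -- `j ≥ K - 1`: `F(t) ≥ 1 - 1/K`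
      have hlev : 1 - 1 / K ≤ cdf ρ t := by
        have hj1 : (K : ℝ) - 1 ≤ j := by
          have : K - 1 ≤ j := by omega
          have e : ((K - 1 : ℕ) : ℝ) = K - 1 := by rw [Nat.cast_sub (by omega), Nat.cast_one]
          rw [← e]
          exact_mod_cast this
        rw [sub_le_iff_le_add, ← sub_le_iff_le_add', le_div_iff₀ hK0] at *
        · nlinarith [mul_comm (K : ℝ) (cdf ρ t)]
      linarith [h1 n t]

/-- **Glivenko–Cantelli, deterministic form with everywhere convergence**: `Fₙ` monotone,
`0 ≤ Fₙ ≤ 1`, `Fₙ(s) ≤ Gₙ(t)` for `s < t`; if `Fₙ(t) → F(t)` and `Gₙ(t) → F(t−)` for every real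
`t` (`F = cdf ρ`), then `Fₙ → F` uniformly on `ℝ`. [ours] -/
theorem tendstoUniformly_cdf_of_tendsto (hmono : ∀ n, Monotone (F n)) (h0 : ∀ n t, 0 ≤ F n t)
    (h1 : ∀ n t, F n t ≤ 1) (hFG : ∀ n s t, s < t → F n s ≤ G n t)
    (hF : ∀ t, Tendsto (fun n => F n t) atTop (𝓝 (cdf ρ t)))
    (hG : ∀ t, Tendsto (fun n => G n t) atTop (𝓝 (leftLim (cdf ρ) t))) :
    TendstoUniformly F (cdf ρ) atTop :=
  tendstoUniformly_cdf_of_tendsto_grid ρ hmono h0 h1 hFG (fun _ _ => hF _) fun _ _ => hG _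

end Sandwich

/-! ## §3 Countable reduction: a dense set and the jump points suffice -/

section Dense

variable (ρ : Measure ℝ) {F G : ℕ → ℝ → ℝ}

/-- **Countable reduction.**  `Fₙ` monotone, `Gₙ(t) ≤ Fₙ(t)`, `Fₙ(s) ≤ Gₙ(t)` for `s < t`
(`F = cdf ρ`).  If `Fₙ(d) → F(d)` on a dense set `D` and, at every JUMP point `t` of `F`
(`F(t−) ≠ F(t)`: the atoms), `Fₙ(t) → F(t)` and `Gₙ(t) → F(t−)`, then `Fₙ(t) → F(t)` and
`Gₙ(t) → F(t−)` at EVERY real `t`. [ours] (at a continuity point, squeeze between two points of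
`D` using right-continuity and the left limit of `F`) -/
theorem tendsto_cdf_of_dense (hmono : ∀ n, Monotone (F n)) (hGF : ∀ n t, G n t ≤ F n t)
    (hFG : ∀ n s t, s < t → F n s ≤ G n t) {D : Set ℝ} (hD : Dense D)
    (hFD : ∀ d ∈ D, Tendsto (fun n => F n d) atTop (𝓝 (cdf ρ d)))
    (hjF : ∀ t, leftLim (cdf ρ) t ≠ cdf ρ t → Tendsto (fun n => F n t) atTop (𝓝 (cdf ρ t)))
    (hjG : ∀ t, leftLim (cdf ρ) t ≠ cdf ρ t →
      Tendsto (fun n => G n t) atTop (𝓝 (leftLim (cdf ρ) t))) (t : ℝ) :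
    Tendsto (fun n => F n t) atTop (𝓝 (cdf ρ t))
      ∧ Tendsto (fun n => G n t) atTop (𝓝 (leftLim (cdf ρ) t)) := by
  by_cases hjump : leftLim (cdf ρ) t ≠ cdf ρ t
  · exact ⟨hjF t hjump, hjG t hjump⟩
  have hcont : leftLim (cdf ρ) t = cdf ρ t := not_ne_iff.1 hjump
  -- below any `a < F(t)` there is a point of `D` to the left of `t` with `a < F(d)`
  have hleft : ∀ a, a < cdf ρ t → ∃ d ∈ D, d < t ∧ a < cdf ρ d := by
    intro a ha
    rw [← hcont] at ha
    have hev : ∀ᶠ s in 𝓝[<] t, a < cdf ρ s ∧ s < t :=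
      (((monotone_cdf ρ).tendsto_leftLim t).eventually (eventually_gt_nhds ha)).and
        self_mem_nhdsWithin
    obtain ⟨s, hs, hst⟩ := hev.exists
    obtain ⟨d, hdD, hsd, hdt⟩ := hD.exists_between hst
    exact ⟨d, hdD, hdt, hs.trans_le (monotone_cdf ρ hsd.le)⟩
  -- above any `b > F(t)` there is a point of `D` to the right of `t` with `F(d) < b`
  have hright : ∀ b, cdf ρ t < b → ∃ d ∈ D, t < d ∧ cdf ρ d < b := by
    intro b hb
    have hrc : Tendsto (cdf ρ) (𝓝[>] t) (𝓝 (cdf ρ t)) :=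
      ((cdf ρ).right_continuous t).mono Ioi_subset_Ici_self
    have hev : ∀ᶠ s in 𝓝[>] t, cdf ρ s < b ∧ t < s :=
      (hrc.eventually (eventually_lt_nhds hb)).and self_mem_nhdsWithin
    obtain ⟨s, hs, hts⟩ := hev.exists
    obtain ⟨d, hdD, htd, hds⟩ := hD.exists_between hts
    exact ⟨d, hdD, htd, (monotone_cdf ρ hds.le).trans_lt hs⟩
  constructor
  · refine tendsto_order.2 ⟨fun a ha => ?_, fun b hb => ?_⟩
    · obtain ⟨d, hdD, hdt, had⟩ := hleft a ha
      filter_upwards [(hFD d hdD).eventually (eventually_gt_nhds had)] with n hn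
      exact hn.trans_le ((hFG n d t hdt).trans (hGF n t))
    · obtain ⟨d, hdD, htd, hdb⟩ := hright b hb
      filter_upwards [(hFD d hdD).eventually (eventually_lt_nhds hdb)] with n hn
      exact (hmono n htd.le).trans_lt hn
  · rw [hcont]
    refine tendsto_order.2 ⟨fun a ha => ?_, fun b hb => ?_⟩
    · obtain ⟨d, hdD, hdt, had⟩ := hleft a ha
      filter_upwards [(hFD d hdD).eventually (eventually_gt_nhds had)] with n hn
      exact hn.trans_le (hFG n d t hdt)
    · obtain ⟨d, hdD, htd, hdb⟩ := hright b hb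
      filter_upwards [(hFD d hdD).eventually (eventually_lt_nhds hdb)] with n hn
      exact ((hGF n t).trans (hmono n htd.le)).trans_lt hn

end Dense

end Summit.Ventures.LatticeQCDFlow.Scoring.GlivenkoCantelli

end
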